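/-
Copyright: cell ym-beyond (HOME `run/shared/lean/pub/ym-beyond/`), seat P3 «lower the summit honestly», gen 12.
-/
import Summits.QuantumFields.YangMills.Theorems.WeakCouplingRates
import Literature.MathematicalPhysics.QuantumFieldTheory.Balaban1983to89.T3FinestHeightTail
import Literature.MathematicalPhysics.QuantumLattice.LatticeGaugeDLRFreeEnergyProofs

/-!
# The single-plaquette large-field tail of the `SU(2)₄` Wilson torus states, uniformly in the (even) volume —
# input L2 of the DLR–chessboard line for crux BULK of the rates route `WeakCouplingRates`

WHAT.  For the Wilson measure of `SU(2)` (fundamental character, the tree's `wilsonMeasure (fundamentalRep (Fin 2)) β`,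
weight `exp(−β Σ_p (2 − Re tr U_p))`) on the torus `(ℤ/Lℤ)⁴`, `L` EVEN, `β ≥ 1`:

* `su2_measureReal_plaqCost_ge_le` — the Peierls–chessboard tail `μ{U : s ≤ 2 − Re tr U_p} ≤ C·β⁶·exp(−β s/2)` for every
  plaquette, every `s ≥ 0`, every even `L ≥ 2`, ONE constant `C` (the host tree's `WilsonPlaquetteTail.measureReal_plaquette_mem_le`
  — reflection positivity + the Fröhlich–Israel–Lieb–Simon chessboard estimate — with the link ball `{|u − 1| ≤ β^{−1/2}}`, exactly as
  in `Balaban1983to89.T3FinestHeightTail.gibbsMeasure_real_dist1_ge_le`, read at coupling `β` instead of `β/N`);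
* `plaquetteLargeFieldRarity_evenSide` — the typed input **L2 (even sides)** of the DLR–chessboard line for the crux
  `Theses.WeakCouplingRates.BulkDominatesColdBox`: for `0 < δ` there is `β₀` with
  `wilsonExpectation_{(L+1)⁴} 𝟙{β^{2δ−1} ≤ plaqCost0 ρ 1 2} ≤ exp(−β^δ)` for all `β ≥ β₀` and all `L` with `L+1` even
  (the observable read through the periodic lift, as in `torusPlaqCov`).

WHAT THIS IS NOT.  Not the odd-side statement (the leaf's `infiniteVolumeLimitPoints` are subsequential, so BULK needs all large
sides; odd sides need the mixed site/link reflection positivity `wilsonExpectation_oddReflectionPositive` and the odd-period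
folding — not done here); not a statement about the mass gap.  Route evidence for `stmt-QuantumFields-19455` only.

References: [FrohlichIsraelLiebSimon1978] Thm. 4.1; E. Seiler, LNP 159 (1982); cell card `p3-g12-files/idea-dlr-chessboard.md`.
-/

set_option autoImplicit false

noncomputable section

open MeasureTheory Filter Topology
open Literature.MathematicalPhysics
open Literature.MathematicalPhysics.QuantumFieldTheory
open Literature.MathematicalPhysics.QuantumLattice
open Literature.MathematicalPhysics.QuantumFieldTheory.Balaban1983to89
open scoped Matrix.Norms.L2Operator
open Literature.Probability.LatticeModels (Torus.proj)

namespace Summit.QuantumFields.YangMills.Theorems.WeakCouplingRates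

/-- The plaquette energy `2 − Re tr W` of `SU(2)` is `2·(1 − reTr W)` (normalised trace of Bałaban's `Setup`). [folklore] -/
theorem two_sub_trace_re_eq (W : (Matrix.specialUnitaryGroup (Fin 2) ℂ)) :
    (2 : ℝ) - (fundamentalRep (Fin 2) W).trace.re = 2 * (1 - Balaban1983to89.reTr W) := by
  have h := reTr_mul_card_SU W
  push_cast at h
  linarith

/-- `Re tr W ≤ 2` on `SU(2)`. [folklore] -/
theorem trace_re_le_two (W : (Matrix.specialUnitaryGroup (Fin 2) ℂ)) : (fundamentalRep (Fin 2) W).trace.re ≤ (2 : ℕ) := by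
  have h := two_sub_trace_re_eq W
  have := GaugeGroup.reTr_le_one W
  push_cast
  linarith

/-- **The single-plaquette energy tail of the `SU(2)` Wilson torus, uniformly in the even volume**:
`μ_{L,β}{U : s ≤ 2 − Re tr U_p} ≤ C β⁶ exp(−β s/2)` for `β ≥ 1`, `s ≥ 0`, `L` even, every plaquette `p = (x; i, j)`.
[cite: FrohlichIsraelLiebSimon1978, Thm. 4.1] -/
theorem su2_measureReal_plaqCost_ge_le :
    ∃ C : ℝ, 0 < C ∧ ∀ {L : ℕ} [NeZero L] [Fact (1 < L)], Even L → ∀ (β : ℝ), 1 ≤ β → ∀ (s : ℝ), 0 ≤ s →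
      ∀ (x : Site 4 L) {i j : Fin 4}, i ≠ j →
        (wilsonMeasure (d := 4) (L := L) (fundamentalRep (Fin 2)) β).real
            {U : GaugeConfig 4 L (Matrix.specialUnitaryGroup (Fin 2) ℂ) | s ≤ 2 - (fundamentalRep (Fin 2) (plaquetteHolonomy U x i j)).trace.re} ≤
          C * β ^ (6 : ℕ) * Real.exp (-(β * s / 2)) := by
  obtain ⟨c, hc, hc1, hball⟩ := HaarSmallBallClosedSubgroup.haar_ball_ge_specialUnitaryGroup (n := Fin 2) one_pos
  refine ⟨2 * Real.exp (8 * 2 * Fintype.card {q : Fin 4 × Fin 4 // q.1 < q.2}) * (c ^ 4)⁻¹, by positivity, ?_⟩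
  intro L _ _ hL β hβ s hs x i j hij
  set ρ := fundamentalRep (Fin 2) with hρdef
  have hρc : Continuous ρ := continuous_fundamentalRep (Fin 2)
  have hβ0 : 0 < β := lt_of_lt_of_le one_pos hβ
  -- the radius `r = β^{-1/2}` and the link ball
  set r : ℝ := (Real.sqrt β)⁻¹ with hr
  have hsβ : 0 < Real.sqrt β := Real.sqrt_pos.2 hβ0
  have hr0 : 0 < r := inv_pos.2 hsβ
  have hr1 : r ≤ 1 := by
    rw [hr]; exact inv_le_one_of_one_le₀ (Real.one_le_sqrt.2 hβ)
  have hr2 : r ^ 2 = β⁻¹ := by rw [hr, inv_pow, Real.sq_sqrt hβ0.le]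
  set B : Set (Matrix.specialUnitaryGroup (Fin 2) ℂ) := {g | dist1 g ≤ r} with hB
  have hBm : MeasurableSet B := measurableSet_le RegularGaugeGroup.measurable_dist1 measurable_const
  have hvol : c * r ^ (2 ^ 2 - 1) ≤ (haarProbability (Matrix.specialUnitaryGroup (Fin 2) ℂ)).real B := by
    have h := hball (haarProbability (Matrix.specialUnitaryGroup (Fin 2) ℂ)) r hr0 hr1
    rw [Fintype.card_fin] at h
    have hset : {V : (Matrix.specialUnitaryGroup (Fin 2) ℂ) | ‖(V : Matrix (Fin 2) (Fin 2) ℂ) - 1‖ ≤ r} = B := by ext V; rfl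
    rw [hset] at h
    rw [measureReal_def]
    exact (ENNReal.ofReal_le_iff_le_toReal (measure_ne_top _ _)).1 h
  have hcr : 0 < c * r ^ (2 ^ 2 - 1) := mul_pos hc (pow_pos hr0 _)
  have hBpos : 0 < (haarProbability (Matrix.specialUnitaryGroup (Fin 2) ℂ)).real B := lt_of_lt_of_le hcr hvol
  -- four-link energies on the ball: `≤ 16 r²`
  have hBen : ∀ g₁ g₂ g₃ g₄ : (Matrix.specialUnitaryGroup (Fin 2) ℂ), g₁ ∈ B → g₂ ∈ B → g₃ ∈ B → g₄ ∈ B →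
      ((2 : ℕ) : ℝ) - (ρ (g₁ * g₂ * g₃⁻¹ * g₄⁻¹)).trace.re ≤ 16 * r ^ 2 := by
    intro g₁ g₂ g₃ g₄ h₁ h₂ h₃ h₄
    simp only [hB, Set.mem_setOf_eq] at h₁ h₂ h₃ h₄
    set W := g₁ * g₂ * g₃⁻¹ * g₄⁻¹ with hW
    have hd : dist1 W ≤ 4 * r := by
      calc dist1 W ≤ dist1 (g₁ * g₂ * g₃⁻¹) + dist1 g₄⁻¹ := GaugeGroup.dist1_mul_le _ _
        _ ≤ dist1 (g₁ * g₂) + dist1 g₃⁻¹ + dist1 g₄⁻¹ := by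
            have := GaugeGroup.dist1_mul_le (g₁ * g₂) g₃⁻¹; linarith
        _ ≤ dist1 g₁ + dist1 g₂ + dist1 g₃⁻¹ + dist1 g₄⁻¹ := by
            have := GaugeGroup.dist1_mul_le g₁ g₂; linarith
        _ = dist1 g₁ + dist1 g₂ + dist1 g₃ + dist1 g₄ := by rw [GaugeGroup.dist1_inv, GaugeGroup.dist1_inv]
        _ ≤ 4 * r := by linarith
    have hq := B10Eq5RegularAction.one_sub_reTr_le_specialUnitaryGroup W
    have hd0 : 0 ≤ dist1 W := GaugeGroup.dist1_nonneg W
    have he : ((2 : ℕ) : ℝ) - (ρ W).trace.re = 2 * (1 - Balaban1983to89.reTr W) := by push_cast; exact two_sub_trace_re_eq W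
    rw [he]
    have hsq : dist1 W ^ 2 ≤ (4 * r) ^ 2 := pow_le_pow_left₀ hd0 hd 2
    nlinarith
  -- the large-field event `√s ≤ |W − 1|`: energy `≥ s/2`
  set θ : ℝ := Real.sqrt s with hθ
  have hθ0 : 0 ≤ θ := Real.sqrt_nonneg s
  set E : Set (Matrix.specialUnitaryGroup (Fin 2) ℂ) := {g | θ ≤ dist1 g} with hE
  have hEm : MeasurableSet E := measurableSet_le measurable_const RegularGaugeGroup.measurable_dist1
  have hEconj : ∀ g h : (Matrix.specialUnitaryGroup (Fin 2) ℂ), h * g * h⁻¹ ∈ E ↔ g ∈ E := fun g h => by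
    simp only [hE, Set.mem_setOf_eq, GaugeGroup.dist1_conj]
  have hEinv : ∀ g : (Matrix.specialUnitaryGroup (Fin 2) ℂ), g⁻¹ ∈ E ↔ g ∈ E := fun g => by
    simp only [hE, Set.mem_setOf_eq, GaugeGroup.dist1_inv]
  have hEen : ∀ g ∈ E, s / 2 ≤ ((2 : ℕ) : ℝ) - (ρ g).trace.re := by
    intro g hg
    simp only [hE, Set.mem_setOf_eq] at hg
    have he : ((2 : ℕ) : ℝ) - (ρ g).trace.re = 2 * (1 - Balaban1983to89.reTr g) := by push_cast; exact two_sub_trace_re_eq g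
    rw [he]
    have h1 := B10Eq71TorusLocal.dist1_sq_le_specialUnitaryGroup g
    have h2 : θ ^ 2 ≤ dist1 g ^ 2 := pow_le_pow_left₀ hθ0 hg 2
    have h3 : θ ^ 2 = s := by rw [hθ, Real.sq_sqrt hs]
    push_cast at h1
    nlinarith
  -- the subset `{s ≤ energy} ⊆ {√s ≤ dist1}`
  have hsub : {U : GaugeConfig 4 L (Matrix.specialUnitaryGroup (Fin 2) ℂ) | s ≤ 2 - (ρ (plaquetteHolonomy U x i j)).trace.re} ⊆
      {U : GaugeConfig 4 L (Matrix.specialUnitaryGroup (Fin 2) ℂ) | plaquetteHolonomy U x i j ∈ E} := by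
    intro U hU
    simp only [Set.mem_setOf_eq] at hU ⊢
    simp only [hE, Set.mem_setOf_eq]
    set W := plaquetteHolonomy U x i j
    have he : (2 : ℝ) - (ρ W).trace.re = 2 * (1 - Balaban1983to89.reTr W) := two_sub_trace_re_eq W
    have hq := B10Eq5RegularAction.one_sub_reTr_le_specialUnitaryGroup W
    have hd0 : 0 ≤ dist1 W := GaugeGroup.dist1_nonneg W
    have hsd : s ≤ dist1 W ^ 2 := by nlinarith
    calc θ = Real.sqrt s := hθ
      _ ≤ Real.sqrt (dist1 W ^ 2) := Real.sqrt_le_sqrt hsd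
      _ = dist1 W := Real.sqrt_sq hd0
  haveI := isProbabilityMeasure_wilsonMeasure (d := 4) (L := L) ρ hρc β
  have hmono : (wilsonMeasure (d := 4) (L := L) ρ β).real
        {U : GaugeConfig 4 L (Matrix.specialUnitaryGroup (Fin 2) ℂ) | s ≤ 2 - (ρ (plaquetteHolonomy U x i j)).trace.re} ≤
      (wilsonMeasure (d := 4) (L := L) ρ β).real {U : GaugeConfig 4 L (Matrix.specialUnitaryGroup (Fin 2) ℂ) | plaquetteHolonomy U x i j ∈ E} :=
    measureReal_mono hsub
  refine hmono.trans ?_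
  -- the host-tree bound at coupling `β`
  have hmain := WilsonPlaquetteTail.measureReal_plaquette_mem_le (d := 4) (L := L) ρ hL hρc trace_re_le_two hβ0.le
    hEm hEconj hEinv hEen hBm hBpos hBen x hij
  refine hmain.trans ?_
  -- arithmetic: `β (16 r²) = 16`, `Haar(B)^4 ≥ (c r³)^4 = c^4 β^{-6}`
  have e2 : β * (16 * r ^ 2) = 16 := by rw [hr2]; field_simp
  rw [e2]
  set X := Real.exp (-(β * (s / 2))) with hX
  have hX0 : 0 < X := Real.exp_pos _
  have hX1 : X ≤ 1 := by
    rw [hX, Real.exp_le_one_iff]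
    have : 0 ≤ β * (s / 2) := by positivity
    linarith
  have hXe : Real.exp (-(β * s / 2)) = X := by rw [hX]; ring_nf
  rw [hXe]
  set P₂ : ℝ := (Fintype.card {q : Fin 4 × Fin 4 // q.1 < q.2} : ℝ) with hP₂
  set Y := Real.exp (16 * P₂) with hY
  have hY0 : 0 < Y := Real.exp_pos _
  have hYe : Real.exp (8 * 2 * P₂) = Y := by rw [hY]; ring_nf
  rw [hYe]
  have hvol_d : (c * r ^ (2 ^ 2 - 1)) ^ 4 ≤ (haarProbability (Matrix.specialUnitaryGroup (Fin 2) ℂ)).real B ^ 4 :=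
    pow_le_pow_left₀ hcr.le hvol _
  have hinv : ((haarProbability (Matrix.specialUnitaryGroup (Fin 2) ℂ)).real B ^ 4)⁻¹ ≤ ((c * r ^ (2 ^ 2 - 1)) ^ 4)⁻¹ :=
    inv_anti₀ (pow_pos hcr _) hvol_d
  have hrpow : ((c * r ^ (2 ^ 2 - 1)) ^ 4)⁻¹ = (c ^ 4)⁻¹ * β ^ (6 : ℕ) := by
    have h3 : (2 : ℕ) ^ 2 - 1 = 3 := by norm_num
    have hr12 : r ^ 12 = (β ^ (6 : ℕ))⁻¹ := by rw [show (12 : ℕ) = 2 * 6 from rfl, pow_mul, hr2, inv_pow]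
    rw [h3, mul_pow, ← pow_mul, show (3 * 4 : ℕ) = 12 from rfl, hr12, mul_inv, inv_inv]
  calc (1 + X) * X * Y / (haarProbability (Matrix.specialUnitaryGroup (Fin 2) ℂ)).real B ^ 4
      = (1 + X) * X * Y * ((haarProbability (Matrix.specialUnitaryGroup (Fin 2) ℂ)).real B ^ 4)⁻¹ := by rw [div_eq_mul_inv]
    _ ≤ 2 * X * Y * ((c * r ^ (2 ^ 2 - 1)) ^ 4)⁻¹ := by
        have h12 : (1 + X) * X * Y ≤ 2 * X * Y := by nlinarith [mul_pos hX0 hY0]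
        exact mul_le_mul h12 hinv (inv_nonneg.2 (pow_nonneg hBpos.le _)) (by positivity)
    _ = 2 * Y * (c ^ 4)⁻¹ * β ^ (6 : ℕ) * X := by rw [hrpow]; ring

/-- Elementary asymptotics: `C β⁶ exp(−β·β^{2δ−1}/2) ≤ exp(−β^δ)` for `β ≥ β₀(δ, C)`. [folklore] -/
theorem poly_exp_tail_le {δ : ℝ} (hδ : 0 < δ) {C : ℝ} (hC : 0 < C) :
    ∃ β₀ : ℝ, 1 ≤ β₀ ∧ ∀ β : ℝ, β₀ ≤ β →
      C * β ^ (6 : ℕ) * Real.exp (-(β * β ^ (2 * δ - 1) / 2)) ≤ Real.exp (-(β ^ δ)) := by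
  have h1 : Tendsto (fun β : ℝ => β ^ δ) atTop atTop := tendsto_rpow_atTop hδ
  have h2 : Tendsto (fun u : ℝ => u ^ (6 / δ) * Real.exp (-1 * u)) atTop (𝓝 0) :=
    tendsto_rpow_mul_exp_neg_mul_atTop_nhds_zero _ _ one_pos
  have hε : (0 : ℝ) < 1 / (C + 1) := by positivity
  have h3 : ∀ᶠ β : ℝ in atTop, (β ^ δ) ^ (6 / δ) * Real.exp (-1 * β ^ δ) ≤ 1 / (C + 1) :=
    (h2.comp h1).eventually (Iic_mem_nhds hε)
  have h4 : ∀ᶠ β : ℝ in atTop, 4 ≤ β ^ δ := h1.eventually_ge_atTop 4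
  obtain ⟨b, hb⟩ := Filter.eventually_atTop.1 (h3.and h4)
  refine ⟨max b 1, le_max_right _ _, fun β hβ => ?_⟩
  have hβb : b ≤ β := (le_max_left _ _).trans hβ
  have hβ1 : 1 ≤ β := (le_max_right _ _).trans hβ
  have hβ0 : 0 < β := by linarith
  obtain ⟨h3β, h4β⟩ := hb β hβb
  have e1 : (β ^ δ) ^ (6 / δ) = β ^ (6 : ℕ) := by
    have h6 : δ * (6 / δ) = ((6 : ℕ) : ℝ) := by field_simp; norm_num
    rw [← Real.rpow_mul hβ0.le, h6, Real.rpow_natCast]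
  have e2 : β * β ^ (2 * δ - 1) = (β ^ δ) ^ (2 : ℕ) := by
    rw [← Real.rpow_natCast (β ^ δ) 2, ← Real.rpow_mul hβ0.le, Nat.cast_ofNat,
      show δ * 2 = 1 + (2 * δ - 1) by ring, Real.rpow_add hβ0, Real.rpow_one]
  rw [e1] at h3β
  rw [e2]
  set u := β ^ δ with hu
  have hexp : Real.exp (-(u ^ (2 : ℕ) / 2)) ≤ Real.exp (-u) * Real.exp (-u) := by
    rw [← Real.exp_add]
    exact Real.exp_le_exp.2 (by nlinarith)
  have hx : β ^ (6 : ℕ) * Real.exp (-u) ≤ 1 / (C + 1) := by simpa [neg_mul, one_mul] using h3β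
  have hCle : C * β ^ (6 : ℕ) * Real.exp (-u) ≤ 1 := by
    calc C * β ^ (6 : ℕ) * Real.exp (-u) = C * (β ^ (6 : ℕ) * Real.exp (-u)) := by ring
      _ ≤ C * (1 / (C + 1)) := mul_le_mul_of_nonneg_left hx hC.le
      _ ≤ 1 := by rw [mul_one_div]; exact (div_le_one (by positivity)).2 (by linarith)
  have hpos : 0 ≤ C * β ^ (6 : ℕ) := by positivity
  calc C * β ^ (6 : ℕ) * Real.exp (-(u ^ (2 : ℕ) / 2))
      ≤ C * β ^ (6 : ℕ) * (Real.exp (-u) * Real.exp (-u)) := mul_le_mul_of_nonneg_left hexp hpos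
    _ = (C * β ^ (6 : ℕ) * Real.exp (-u)) * Real.exp (-u) := by ring
    _ ≤ 1 * Real.exp (-u) := mul_le_mul_of_nonneg_right hCle (Real.exp_pos _).le
    _ = Real.exp (-u) := one_mul _

/-- **L2 (even sides) of the DLR–chessboard line for crux BULK** (`Theses.WeakCouplingRates.BulkDominatesColdBox`): the crude
large-field event `{β^{2δ−1} ≤ plaqCost0}` of one plaquette has `wilsonExpectation ≤ exp(−β^δ)` for `β ≥ β₀(δ)`, for EVERY torus
`(L+1)⁴` of even side — the observable read through the periodic lift exactly as in `torusPlaqCov`.  (Odd sides: open; they need the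
mixed reflection positivity `wilsonExpectation_oddReflectionPositive` and the odd-period chessboard folding.)
[cite: FrohlichIsraelLiebSimon1978, Thm. 4.1] -/
theorem plaquetteLargeFieldRarity_evenSide {δ : ℝ} (hδ : 0 < δ) :
    ∃ β₀ : ℝ, ∀ β : ℝ, β₀ ≤ β → ∀ L : ℕ, Even (L + 1) →
      wilsonExpectation (L := L + 1) (fundamentalRep (Fin 2)) β
          (toTorusObservable (L + 1) fun U : LGConfig 4 (Matrix.specialUnitaryGroup (Fin 2) ℂ) =>
            if β ^ (2 * δ - 1) ≤ plaqCost0 (fundamentalRep (Fin 2)) 1 2 U then (1 : ℝ) else 0) ≤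
        Real.exp (-(β ^ δ)) := by
  obtain ⟨C, hC, hmain⟩ := su2_measureReal_plaqCost_ge_le
  obtain ⟨β₀, hβ₀1, hasy⟩ := poly_exp_tail_le hδ hC
  refine ⟨β₀, fun β hβ L hL => ?_⟩
  have hβ1 : 1 ≤ β := hβ₀1.trans hβ
  have hβ0 : 0 < β := by linarith
  haveI : Fact (1 < L + 1) := ⟨by obtain ⟨k, hk⟩ := hL; omega⟩
  set ρ := fundamentalRep (Fin 2) with hρdef
  have hρc : Continuous ρ := continuous_fundamentalRep (Fin 2)
  -- the event, on the torus
  set S : Set (GaugeConfig 4 (L + 1) (Matrix.specialUnitaryGroup (Fin 2) ℂ)) :=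
    {U | β ^ (2 * δ - 1) ≤ 2 - (ρ (plaquetteHolonomy U (Torus.proj (L + 1) 0) 1 2)).trace.re} with hS
  have hcont : Continuous fun g : (Matrix.specialUnitaryGroup (Fin 2) ℂ) => (ρ g).trace.re := Complex.continuous_re.comp hρc.matrix_trace
  have hmeas : Measurable fun U : GaugeConfig 4 (L + 1) (Matrix.specialUnitaryGroup (Fin 2) ℂ) =>
      (2 : ℝ) - (ρ (plaquetteHolonomy U (Torus.proj (L + 1) 0) 1 2)).trace.re :=
    (hcont.measurable.comp (measurable_plaquetteHolonomy _ _ _)).const_sub 2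
  have hSm : MeasurableSet S := measurableSet_le measurable_const hmeas
  -- the Wilson expectation of the indicator is the probability of the event
  have hind : (toTorusObservable (L + 1) fun U : LGConfig 4 (Matrix.specialUnitaryGroup (Fin 2) ℂ) =>
        if β ^ (2 * δ - 1) ≤ plaqCost0 ρ 1 2 U then (1 : ℝ) else 0) = S.indicator 1 := by
    funext U
    simp only [toTorusObservable_apply, hS, Set.indicator_apply, Set.mem_setOf_eq, plaqCost0, QuantumLattice.plaquetteObs,
      FreeEnergy.plaquetteHolonomyZd_torusLift, Pi.one_apply, Nat.cast_ofNat]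
  have hexp : wilsonExpectation (L := L + 1) ρ β (toTorusObservable (L + 1) fun U : LGConfig 4 (Matrix.specialUnitaryGroup (Fin 2) ℂ) =>
        if β ^ (2 * δ - 1) ≤ plaqCost0 ρ 1 2 U then (1 : ℝ) else 0) = (wilsonMeasure (d := 4) (L := L + 1) ρ β).real S := by
    rw [hind]
    exact integral_indicator_one hSm
  rw [hexp]
  have hs : (0 : ℝ) ≤ β ^ (2 * δ - 1) := Real.rpow_nonneg hβ0.le _
  have h12 : (1 : Fin 4) ≠ 2 := by decide
  exact (hmain hL β hβ1 _ hs (Torus.proj (L + 1) 0) h12).trans (hasy β hβ)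

/-- **Registered stub `stub_largeFieldRarityEven` of crux `stmt-QuantumFields-19455` (BULK)** — L2 (even sides) of the DLR–chessboard
line, by name and signature. [cite: FrohlichIsraelLiebSimon1978, Thm. 4.1] -/
theorem stub_largeFieldRarityEven : ∀ δ : ℝ, 0 < δ → ∃ β₀ : ℝ, ∀ β : ℝ, β₀ ≤ β → ∀ L : ℕ, Even (L + 1) →
    Literature.MathematicalPhysics.QuantumFieldTheory.wilsonExpectation (L := L + 1)
      (Literature.MathematicalPhysics.QuantumLattice.fundamentalRep (Fin 2)) β
      (Literature.MathematicalPhysics.QuantumLattice.toTorusObservable (L + 1) fun U :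
          Literature.MathematicalPhysics.QuantumLattice.LGConfig 4 (Matrix.specialUnitaryGroup (Fin 2) ℂ) =>
        if β ^ (2 * δ - 1) ≤ Summit.QuantumFields.YangMills.Theorems.WeakCouplingRates.plaqCost0
            (Literature.MathematicalPhysics.QuantumLattice.fundamentalRep (Fin 2)) 1 2 U then (1 : ℝ) else 0) ≤
      Real.exp (-(β ^ δ)) :=
  fun _ hδ => plaquetteLargeFieldRarity_evenSide hδ

end Summit.QuantumFields.YangMills.Theorems.WeakCouplingRates
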